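import Summits.QuantumFields.YangMills.Theorems.BalabanUVNodesN26CPtLeafwise
import Literature.MathematicalPhysics.QuantumFieldTheory.Balaban1983to89.Node00.Record12CarriersB13Family
import Literature.MathematicalPhysics.QuantumFieldTheory.Balaban1983to89.Node00.Record12Numerics

/-!
# DAG node N26 — B4 «β-continuity» AT THE STAGE-12 RECORD FROM THE RECORD'S [B13] FAMILY OF RECORD: the (D4) chain along RUN SEQUENCES through a Stage-12
# history-indexed [B13] family `lamF : Node00.ResidB13Fam₁₂ F N θ` AT FIXED HISTORY, N10's in-edge in the FAMILY currency `Node00.B13FamLeafOfRecord₁₂`, the chain's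
# constants = THE LETTERS OF RECORD `Node00.c13OfRecord₁₂ θ c₀` — N2's restriction R22 at ℓ = ½L DISCHARGED — and crux K2′'s registered stub `D4AtSlopeOfD1Record12` AT θ

Cell `pub-ymgap`, YM-PLAN Track A (HUMAN RULING D-0062), seat `pub-ymgap-dag-n26-c` gen 4 (R134 acceleration seat, s2; harness re-seat; director-ym row «the (D4)-chain
INSTANCE `Gaps.BetaContFromD4Chain.betaContH_of_chainTFac190H` for the datum of record at `betaOfRecord₁₁` (crew D4 files by name)»; gen-3 HANDOFF trigger (t10) «a
family-carrying [B13] restate ⇒ instantiate `…N26AtRecord12B13RunLayers` §1 at it»).  Over node00-def-B13 g3's `Node00.Record12CarriersB13Family` (p476387: the [B13] layer in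
the HISTORY-INDEXED FAMILY currency `ResidB13Fam θ₃ = (k : ℕ) → (Fin (k+1) → ℝ) → ResidB13 θ₃` — the currency N09's (iv⁵) consumer and [I]'s Theorem 3 read —, the Stage-12
LETTERS OF RECORD `c13OfRecord₁₂ θ c := { c with L := ℓ₆+1, δ := (1 − 2∕L)∕10, γ := θ.γ, E₀, κ := (I.1.18)'s }` with **`c13OfRecord₁₂_R22` PROVED**, the family leaf of
record `B13FamLeafOfRecord₁₂ θ c lamF P` and the member bridge `b13LeafOfRecord_member₁₂`), the row-(D4) owner's `W`-adapter `Beta.RemainderWOfRecordB13.polLeavesTFac190H_ofRecordB13`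
(b2b-balaban-beta-an4 g122, p462936) and this seat's lineage (p457986 §1–§2, p461633 §0–§1, p472048 §1).

WHY THIS FILE.  `…N26AtRecord12B13RunLayers` §1 (p470063 ∕ v1.1 p476414) reads the (D4) chain along run sequences `Ps k v : ℕ → B12.RunParams` through SINGLE-STEP layers
`lam13 : B12.RunParams → ResidB13 θ₃` (the DAG slot: ONE step datum per run) at free common constants `c` with N2's `h22 : c.R22gen (L∕2)` displayed.  Print's object is
the FAMILY: at scale `k` and history `v = (g_0, …, g_k)` the (1.21) limit `T^{(k+1)} ↗ ℤ⁴` runs over lattices carrying THE SAME step-`k` expansion at THE SAME history.  In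
def-B13's currency that is literally `m ↦ lamF (Ps k v m) k v` — the member AT (k, v) of the family of the run `Ps k v m` —, N10's in-edge is the family leaf of record
`∀ P, B13FamLeafOfRecord₁₂ F N θ c₀ lamF P` on the window of record, the constants the Lemmas read ARE the letters of record `c13OfRecord₁₂ F N θ c₀` (member letters law
`(lamF P k v).c = c13OfRecord₁₂ θ c₀` on the box — the conjunct def-B13's honesty theorem displays), and **N2's R22 at ℓ = ½L is an IDENTITY of those letters**
(`r22gen_half_c13OfRecord₁₂` = `c13OfRecord₁₂_R22` through `B13.Consts.R22gen_half_iff`): every consumer below is `h22`-FREE.  Every per-member hypothesis is asked ONLY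
ON THE BOX `v ∈ Box γ₀ k` (`γ₀ ≤ θ.γ`), where the chain reads it.

WHAT IS HERE (0 `def`, 0 `sorry`; compositions BY NAME).  §0 `r22gen_half_c13OfRecord₁₂`; the member faces `c13OfRecord_member_of_family` ∕ `b13LeafOfRecord_member_of_family`
(instance leaf `B13LeafOfRecord θ₃ (lamF P k v)` at box members from the family leaf of record + the letters law, `b13LeafOfRecord_member₁₂` + `FlowStep.box_mono`).
§1 AT A STAGE-12 TUPLE θ with a family `lamF`, residual letters `c₀`, a view run `p`, leaf kernels `A1` with the (1.22) identification `hm` at the view on a box `γ₀ ≤ θ.γ`,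
run sequences `Ps k v` with the members' tori `(lamF (Ps k v m) k v).n ↗`, the laws ∕ restriction sentence ∕ (4.4) seams ∕ (190) data ∕ (1.7) data ON THE BOX:
`exists_chainTFac190H_view_of_family` (the instance `ChainTFac190H 4 M μ ν (oneLoopSplitOfRecord₁₁ F N (θ.toStage11 F N p)) γ₀ (c13OfRecord₁₂ F N θ c₀) (L∕2) α₂ q` with the
handles `R.A1 = A1`, `(R.leaves k v hv).N = m ↦ (lamF (Ps k v m) k v).n + 1` and `W ≍ m ↦ (WtOfRecord θ₃ (lamF (Ps k v m) k v)).toTorusStep` — dag-ref-D's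
WATCH-D4-TORUS-SEQUENCE by type: the tori and steps are THE RECORD FAMILY's MEMBERS' at fixed history, `hn` displayed), `atSlopeCont_view_of_family`, `betaContH_view_of_family`,
`n26_datumOfRecord₁₂_of_family`, `endpoint_and_n26_datumOfRecord₁₂_of_family`, **`d4AtSlopeOfD1Record12_at_of_family`** (crux K2′ `EndpointGivenBR12`'s registered stub
`stub_d4AtSlopeCont12 : D4AtSlopeOfD1Record12`, plan `D64-REV15/K2Skeleton12.lean` 796556caff13e573, AT THE TUPLE θ in the stub's own letters — `h22`-free) and
`d4AtSlopeOfD1Record12_at_of_family_leafwise` ((C-pt) replaced by history-continuity of the (1.7) read-outs, p472048's `atSlopeCont_of_chainTFac190H_leafwise`).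

HONEST FRAMING.  Nothing of Bałaban's is constructed; no estimate is proved (R22 is an identity of letters, [II] p. 21 «or δ = (1∕10)(1 − 2L⁻¹)»).  The family `lamF`, the
letters `c₀`, the run sequences, laws, seams, (190) data, (1.7) data, the (1.22) identification at the view, N1 ∕ N3 (`CondsL`, `Valid`, `SignsL` — now conditions on the
RECORD's `κ = θ.s2.lf.κ`, `L = θ.L` and the residual letters), the one-loop slope and (C-pt) ∕ (C-leaf) are displayed HYPOTHESES on the record's RESIDUAL objects.  def-B13's
honesty (their §3) applies verbatim: the constant ZERO family with full spaces passes the family leaf of record — contentfulness = the TERM TOWER OF RECORD proper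
(identification of each member's terms with the record's step-`k` expansion at history `v`; XL, absent) or N10's ∀-lawful ∕ termwise currency member-wise.  (D4) INSTANCE
0∕1, D4 DISCHARGE NO DATE; `stub_d4AtSlopeCont12` NOT proved (§1 is a REDUCTION of its body at θ); N10 ∕ N25 ∕ N26 NOT discharged; counts unmoved.  WATCH-N26-LIMIT-JUNK
(dag-ref-D READ #106, inherited): where the (1.21) limit exists nowhere the merged β of record is history-constant and B4 holds BY JUNK; content only with `hm`.  One finite
four-torus programme at fixed ε per run — NOT the continuum limit, NOT ℝ⁴, NOT infinite volume, NOT OS, NOT a mass gap, NOT Clay.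
Sources (context): [I] = [Balaban1987RG1] CMP **109** (1987): Thm 2 p. 259, Thm 3 p. 264, (1.7) p. 261, (1.18) p. 263, (1.20)–(1.22) p. 264, (2.12)–(2.13) p. 268, (4.4)
p. 281, (5.10) p. 293; [II] = [Balaban1988RG2Cluster] CMP **116** (1988): Lemmas 1–3 pp. 9, 11, 20, (2.13) p. 14, p. 15, (2.38) p. 20, p. 21; [15] = [Balaban1985Variational]
CMP **102** (1985): (190) p. 308.
-/

noncomputable section

open scoped Matrix.Norms.L2Operator

namespace Summit.QuantumFields.YangMills.Theorems.BalabanUVNodesN26AtRecord12B13Family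

open Literature.MathematicalPhysics.QuantumFieldTheory.Balaban1983to89
open Literature.MathematicalPhysics.QuantumFieldTheory.Balaban1983to89.FlowStep
open Literature.MathematicalPhysics.QuantumFieldTheory.Balaban1983to89.DagBinding (EndpointExistence)
open Literature.MathematicalPhysics.QuantumFieldTheory.Balaban1983to89.T4Continuum (T4Family)
open Literature.MathematicalPhysics.QuantumFieldTheory.Balaban1983to89.Node00
open Literature.MathematicalPhysics.QuantumFieldTheory.Balaban1983to89.B13ScaleTransfer (Pt)
open Literature.MathematicalPhysics.QuantumFieldTheory.Balaban1983to89.TreeLengthTorus (TDom proj)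
open Literature.MathematicalPhysics.QuantumFieldTheory.Balaban1983to89.B12Decay510 (mixedDeriv)
open Literature.MathematicalPhysics.QuantumFieldTheory.Balaban1983to89.Beta.RemainderChainLattice
open Literature.MathematicalPhysics.QuantumFieldTheory.Balaban1983to89.Beta.RemainderLimitTorus (LDom limKernel tproj)
open Literature.MathematicalPhysics.QuantumFieldTheory.Balaban1983to89.Beta.RemainderDecay190 (Consts190 Data190)
open Literature.MathematicalPhysics.QuantumFieldTheory.Balaban1983to89.Beta.RemainderDecay190HoloChain (ChainTFac190H)
open Literature.MathematicalPhysics.QuantumFieldTheory.Balaban1983to89.Beta.RemainderWOfRecordB13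
open Literature.MathematicalPhysics.QuantumFieldTheory.Balaban1983to89.Beta.OneStepKernelFamily (TbalOf)
open Literature.MathematicalPhysics.QuantumFieldTheory.Balaban1983to89.Beta.OneStepResolventKernel (JetData)
open Summit.QuantumFields.BalabanUV.Gaps
open Summit.QuantumFields.BalabanUV.Gaps.BetaContFromD4Chain
open Summit.QuantumFields.YangMills.Theorems.BalabanUVNodesN26AtBetaOfRecord11StepObjects
  (beta1_eq_oneLoopSplitOfRecord₁₁_of_merged betaContH_betaOfRecord₁₁_of_exists_chainTFac190H atSlopeCont_oneLoopSplitOfRecord₁₁_of_exists_chainTFac190H)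
open Summit.QuantumFields.YangMills.Theorems.BalabanUVNodesN26AtRecord12
  (n26_datumOfRecord₁₂_of_exists_chainTFac190H_view endpoint_and_n26_datumOfRecord₁₂_of_residue_atSlopeCont)
open Summit.QuantumFields.YangMills.Theorems.BalabanUVNodesN26CPtLeafwise (atSlopeCont_of_chainTFac190H_leafwise)
open Metric Filter Topology

variable (F : T4Family) (N : ℕ) [NeZero N]

/-! ## §0 N2's restriction at the letters of record; the family's members on the box: letters of record and N10's instance leaf -/

section Members

variable {γ₀ : ℝ} (θ : Stage12Params F N) (c₀ : B13.Consts) (lamF : ResidB13Fam₁₂ F N θ)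

/-- **N2's RESTRICTION R22 AT ℓ = ½L IS AN IDENTITY OF THE LETTERS OF RECORD**: the (D4) chain's hypothesis `h22 : c.R22gen (L∕2)` (p457986 §2, an4's p468083 §2–§3, p461633
§1, p470063 §1) holds at `c := c13OfRecord₁₂ F N θ c₀` — node00-def-B13's `c13OfRecord₁₂_R22` («(1 − 10δ)·½L = 1» at `δ := (1 − 2∕L)∕10`) read through
`B13.Consts.R22gen_half_iff` (`Iff.rfl`).  One displayed numeric input of the N26 ∕ (D4) junction DISCHARGED at the record. [cite: Balaban1988RG2Cluster, p.21 (after (2.41): «or δ = (1∕10)(1 − 2L⁻¹)»)] -/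
theorem r22gen_half_c13OfRecord₁₂ : (c13OfRecord₁₂ F N θ c₀).R22gen (((c13OfRecord₁₂ F N θ c₀).L : ℝ) / 2) :=
  (B13.Consts.R22gen_half_iff _).2 (c13OfRecord₁₂_R22 F N θ c₀)

variable {θ c₀ lamF}

/-- **Member face — letters**: under the member letters law on the box (`(lamF P k v).c = c13OfRecord₁₂ θ c₀`, the conjunct def-B13's honesty theorem displays), the
constants of record of every box member ARE the letters of record (`c13OfRecord_eq_c13OfRecord₁₂`) — the chain's «common constants» `hc` in the family currency.
[cite: Balaban1988RG2Cluster, p.9 and p.21 (the constants are the expansion's, uniform in the step; bookkeeping)] -/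
theorem c13OfRecord_member_of_family (hcF : ∀ P k v, v ∈ Box γ₀ k → (lamF P k v).c = c13OfRecord₁₂ F N θ c₀) {k : ℕ} {v : Fin (k + 1) → ℝ}
    (hv : v ∈ Box γ₀ k) (P : B12.RunParams) : c13OfRecord θ.toStage3Params (lamF P k v) = c13OfRecord₁₂ F N θ c₀ :=
  c13OfRecord_eq_c13OfRecord₁₂ F N θ c₀ _ (hcF P k v hv)

/-- **Member face — N10's leaf**: the FAMILY leaf of record at every run (`B13FamLeafOfRecord₁₂`, N10's in-edge in def-B13's ∕ N09's (iv⁵) currency, box = the window of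
record `θ.γ`) + the member letters law on a box `γ₀ ≤ θ.γ` ⟹ g0's INSTANCE leaf `B13LeafOfRecord θ₃ (lamF P k v)` at every member `(k, v)` of that box — the leaf the
(D4) wall's adapter `polLeavesTFac190H_ofRecordB13` reads layer by layer (`b13LeafOfRecord_member₁₂` + `FlowStep.box_mono`). [cite: Balaban1988RG2Cluster, Lemma 1 p.9, Lemma 2 p.11, Lemma 3 p.20; Balaban1987RG1, Thm 3 p.264 (the family over the run)] -/
theorem b13LeafOfRecord_member_of_family (hle : γ₀ ≤ θ.γ) (hcF : ∀ P k v, v ∈ Box γ₀ k → (lamF P k v).c = c13OfRecord₁₂ F N θ c₀)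
    (hleafF : ∀ P, B13FamLeafOfRecord₁₂ F N θ c₀ lamF P) {k : ℕ} {v : Fin (k + 1) → ℝ} (hv : v ∈ Box γ₀ k) (P : B12.RunParams) :
    B13LeafOfRecord θ.toStage3Params (lamF P k v) :=
  b13LeafOfRecord_member₁₂ (hleafF P) (box_mono hle k hv) (hcF P k v hv)

end Members

/-! ## §1 At a Stage-12 tuple with a [B13] family of record: the (D4) chain along run sequences AT FIXED HISTORY, its consumers, K2′'s stub at θ — all `h22`-free -/

section Family

variable {γ₀ : ℝ} {M : ℕ} [NeZero M] {μ ν : Fin 4} {α₂ : ℝ} {q : Consts190}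
variable (θ : Stage12Params F N) (p : B12.RunParams) (c₀ : B13.Consts) (lamF : ResidB13Fam₁₂ F N θ) (hle : γ₀ ≤ θ.γ)
  -- the leaf kernels and the (1.22) identification in the record's letters at the view (any run `p`; the view's Stage-9 part IS θ's)
  (A1 : (k : ℕ) → (Fin (k + 1) → ℝ) → LDom 4 → Pt 4 → ℝ)
  (hm : ∀ k (v : Fin (k + 1) → ℝ), v ∈ Box γ₀ k →
    betaMergedOfRecord₁₁ F N (θ.toStage11 F N p) k v =
      beta0OfRecord₁₁ F N (θ.toStage11 F N p) k + B12Beta.secondMoment (fun _ _ => limKernel (A1 k v)) μ ν)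
  -- N10's in-edge in the FAMILY currency at every run, and the member letters law on the box
  (hcF : ∀ P k v, v ∈ Box γ₀ k → (lamF P k v).c = c13OfRecord₁₂ F N θ c₀)
  (hleafF : ∀ P, B13FamLeafOfRecord₁₂ F N θ c₀ lamF P)
  -- per (scale, history) IN THE BOX: a RUN SEQUENCE whose families' members AT THAT HISTORY have growing coarse tori ([I] (1.21)), their laws and restriction sentences
  (Ps : (k : ℕ) → (Fin (k + 1) → ℝ) → ℕ → B12.RunParams)
  (hn : ∀ k v, v ∈ Box γ₀ k → Tendsto (fun m => (lamF (Ps k v m) k v).n) atTop atTop)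
  (hsp : ∀ k v, v ∈ Box γ₀ k → ∀ m, SpLaw (lamF (Ps k v m) k v)) (h213 : ∀ k v, v ∈ Box γ₀ k → ∀ m, Law213 (lamF (Ps k v m) k v))
  (hR : ∀ k v, v ∈ Box γ₀ k → ∀ m, (lamF (Ps k v m) k v).Restr)
  -- N1 ∕ N3 at the LETTERS OF RECORD and ℓ = ½L (conditions on the record's κ, L and the residual letters)
  (hC : CondsL 4 (c13OfRecord₁₂ F N θ c₀) (((c13OfRecord₁₂ F N θ c₀).L : ℝ) / 2)) (hs : SignsL (c13OfRecord₁₂ F N θ c₀) α₂ q.B₃)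
  -- the (4.4) seams into the members' spaces p. 15, with the members' ACTIVITIES holomorphic along them (on the box)
  (Wn : (k : ℕ) → (Fin (k + 1) → ℝ) → ℕ → Type) (instW : ∀ k v m, NormedAddCommGroup (Wn k v m))
  (instWs : ∀ k v m, NormedSpace ℂ (Wn k v m))
  (emb : (k : ℕ) → (v : Fin (k + 1) → ℝ) → (m : ℕ) → TDom 4 ((lamF (Ps k v m) k v).n + 1) → Wn k v m → (lamF (Ps k v m) k v).Φ)
  (hemb : ∀ k v, v ∈ Box γ₀ k → ∀ m X, ∀ u ∈ ball (0 : Wn k v m) α₂, emb k v m X u ∈ (lamF (Ps k v m) k v).sp2 X)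
  (hH : ∀ k v, v ∈ Box γ₀ k → ∀ m (X Z : TDom 4 ((lamF (Ps k v m) k v).n + 1)), Z.1 ⊆ X.1 →
    DifferentiableOn ℂ (fun u => (lamF (Ps k v m) k v).H Z (emb k v m X u)) (ball 0 α₂))
  -- the (190)-side data on the members' tori and the (1.7) ∕ test-vector-limit data with the read-out of the leaf kernels (on the box)
  (D : (k : ℕ) → (v : Fin (k + 1) → ℝ) → Data190 4 M (NOfLayers fun m => lamF (Ps k v m) k v) (Wn k v) q)
  (V : (k : ℕ) → (Fin (k + 1) → ℝ) → LDom 4 → Type) (instV : ∀ k v Y, NormedAddCommGroup (V k v Y))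
  (instVs : ∀ k v Y, NormedSpace ℂ (V k v Y))
  (Fw : (k : ℕ) → (v : Fin (k + 1) → ℝ) → (Y : LDom 4) → V k v Y → ℂ)
  (hFd : ∀ k v, v ∈ Box γ₀ k → ∀ Y, ∃ ρ > 0, DifferentiableOn ℂ (Fw k v Y) (ball 0 ρ))
  (r : (k : ℕ) → (v : Fin (k + 1) → ℝ) → (m : ℕ) → (Y : LDom 4) → Wn k v m →L[ℂ] V k v Y)
  (hfac : ∀ k v, v ∈ Box γ₀ k → ∀ Y : LDom 4, ∀ᶠ m in atTop, ∀ u ∈ ball (0 : Wn k v m) α₂,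
    (lamF (Ps k v m) k v).Ek1 (tproj ((lamF (Ps k v m) k v).n + 1) Y) (emb k v m (tproj ((lamF (Ps k v m) k v).n + 1) Y) u) =
      Fw k v Y (r k v m Y u))
  (t : (k : ℕ) → (v : Fin (k + 1) → ℝ) → (Y : LDom 4) → Pt 4 → V k v Y)
  (hconv : ∀ k v, v ∈ Box γ₀ k → ∀ (Y : LDom 4) (x : Pt 4),
    Tendsto (fun m => r k v m Y ((D k v).hn m (tproj ((lamF (Ps k v m) k v).n + 1) Y) (proj (((lamF (Ps k v m) k v).n + 1) * M) x)))
      atTop (𝓝 (t k v Y x)))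
  (ha : ∀ k v, v ∈ Box γ₀ k → ∀ (Y : LDom 4) (z : Pt 4), A1 k v Y z = (mixedDeriv (Fw k v Y) (t k v Y 0) (t k v Y z)).re)

include hle hm hcF hleafF hn hsp h213 hR hC hs instW instWs hemb hH hFd hfac hconv ha

/-- **THE (D4)-CHAIN INSTANCE AT THE STAGE-12 VIEW's SPLIT FROM THE RECORD's [B13] FAMILY, RUN SEQUENCES AT FIXED HISTORY** (`h22`-free; built inline over the row-(D4)
owner's `polLeavesTFac190H_ofRecordB13` and p457986's `beta1_eq_oneLoopSplitOfRecord₁₁_of_merged`): leaf kernels `A1` with the (1.22) identification at the view on a box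
`γ₀ ≤ θ.γ`; N10's FAMILY leaf of record at every run + the member letters law; PER (k, v) IN THE BOX a run sequence `Ps k v` whose families' members AT THE HISTORY (k, v) have
coarse tori growing without bound ([I] (1.21) at fixed scale and history), their laws ∕ restriction sentences, and the (4.4) seams ∕ (190) data ∕ (1.7) data on them ⟹
`∃ R : ChainTFac190H 4 M μ ν (oneLoopSplitOfRecord₁₁ F N (θ.toStage11 F N p)) γ₀ (c13OfRecord₁₂ F N θ c₀) (L∕2) α₂ q` with the HANDLES `R.A1 = A1`,
`(R.leaves k v hv).N = m ↦ (lamF (Ps k v m) k v).n + 1` and `(R.leaves k v hv).W ≍ m ↦ (WtOfRecord θ₃ (lamF (Ps k v m) k v)).toTorusStep` — dag-ref-D's WATCH-D4-TORUS-SEQUENCE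
by type: the tori and the one-step data of every leaf list are THE RECORD FAMILY's MEMBERS' at fixed history (`hn` a displayed binder, never a constant sequence).
Instance 0∕1. [cite: Balaban1987RG1, Thm 3 p.264, (1.7) p.261, (1.21)-(1.22) p.264 and (4.4) p.281; Balaban1988RG2Cluster, (2.13) p.14, p.15, Lemma 3 (2.38) p.20 and p.21; Balaban1985Variational, (190) p.308] -/
theorem exists_chainTFac190H_view_of_family :
    ∃ R : ChainTFac190H 4 M μ ν (oneLoopSplitOfRecord₁₁ F N (θ.toStage11 F N p)) γ₀ (c13OfRecord₁₂ F N θ c₀)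
        (((c13OfRecord₁₂ F N θ c₀).L : ℝ) / 2) α₂ q,
      R.A1 = A1 ∧ ∀ k (v : Fin (k + 1) → ℝ) (hv : v ∈ B12Beta.HistBox γ₀ k),
        (R.leaves k v hv).N = (fun m => (lamF (Ps k v m) k v).n + 1) ∧
          HEq (R.leaves k v hv).W (fun m => (WtOfRecord θ.toStage3Params (lamF (Ps k v m) k v)).toTorusStep) := by
  refine ⟨{ A1 := A1
            beta1_eq := beta1_eq_oneLoopSplitOfRecord₁₁_of_merged F N (θ.toStage11 F N p) hle A1 hm
            leaves := fun k v hv =>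
              haveI hv' : v ∈ Box γ₀ k := (histBox_eq_box γ₀ k) ▸ hv
              polLeavesTFac190H_ofRecordB13 (fun m => lamF (Ps k v m) k v) (hn k v hv') (c13OfRecord₁₂ F N θ c₀) α₂ q
                (fun m => c13OfRecord_member_of_family F N hcF hv' (Ps k v m)) (hsp k v hv') (h213 k v hv')
                (fun m => b13LeafOfRecord_member_of_family F N hle hcF hleafF hv' (Ps k v m)) (hR k v hv') hC hs.A (Wn k v)
                (instW := instW k v) (instWs := instWs k v) (emb k v) (hemb k v hv') (hH k v hv') (D k v) (V k v)
                (instV := instV k v) (instVs := instVs k v) (Fw k v) (hFd k v hv') (r k v) (hfac k v hv') (t k v)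
                (hconv k v hv') (A1 k v) (ha k v hv') }, rfl, fun k v hv => ⟨rfl, HEq.rfl⟩⟩

/-- **THE ROWS-(D4) ∧ B4 RESIDUE AT THE VIEW's SPLIT FROM THE RECORD's [B13] FAMILY — `h22`-FREE**: the family list of this section, the (1.22) identification at the
view, N1 ∕ N3 at the letters of record (`CondsL`, `Valid`, `SignsL`), smallness `ε₁·K_rem,L ≤ s` and (C-pt) on the leaf kernels ⟹
`AtSlopeCont (oneLoopSplitOfRecord₁₁ F N (θ.toStage11 F N p)) γ₀ s` (p457986's `atSlopeCont_oneLoopSplitOfRecord₁₁_of_exists_chainTFac190H`, N2's `h22` supplied by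
`r22gen_half_c13OfRecord₁₂`).  Instance 0∕1. [cite: Balaban1988RG2Cluster, p.15, Lemma 3 (2.38) p.20 and p.21; Balaban1987RG1, (1.7) p.261, (1.20)-(1.22) p.264, (4.4) p.281 and (5.10) p.293; Balaban1985Variational, (190) p.308] -/
theorem atSlopeCont_view_of_family (hq : q.Valid (c13OfRecord₁₂ F N θ c₀).δ₀) {s : ℝ}
    (hsmall : (c13OfRecord₁₂ F N θ c₀).ε₁ * remCoeffL 4 M (c13OfRecord₁₂ F N θ c₀) α₂ q.B₃ ≤ s)
    (hcpt : ∀ k (x : Pt 4), ContinuousOn (fun v : Fin (k + 1) → ℝ => limKernel (A1 k v) x) (Box γ₀ k)) :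
    AtSlopeCont (oneLoopSplitOfRecord₁₁ F N (θ.toStage11 F N p)) γ₀ s := by
  obtain ⟨R, hA, -⟩ := exists_chainTFac190H_view_of_family F N θ p c₀ lamF hle A1 hm hcF hleafF Ps hn hsp h213 hR hC hs Wn instW
    instWs emb hemb hH D V instV instVs Fw hFd r hfac t hconv ha
  exact atSlopeCont_oneLoopSplitOfRecord₁₁_of_exists_chainTFac190H F N (θ.toStage11 F N p) ⟨R, hA⟩ hC
    (r22gen_half_c13OfRecord₁₂ F N θ c₀) hq hs hsmall hcpt

/-- **B4 AT THE VIEW's β OF RECORD FROM THE RECORD's [B13] FAMILY — `h22`-FREE**: the family list, the (1.22) identification at the view, N1 ∕ N3 at the letters of record and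
(C-pt) ⟹ `BetaContH γ₀ (betaOfRecord₁₁ F N (θ.toStage11 F N p))` (p457986's `betaContH_betaOfRecord₁₁_of_exists_chainTFac190H`).  Instance 0∕1.
[cite: Balaban1987RG1, (1.7) p.261, (1.20)-(1.22) p.264 and (5.10) p.293; Balaban1988RG2Cluster, Lemma 3 (2.38) p.20 and p.21; Balaban1985Variational, (190) p.308] -/
theorem betaContH_view_of_family (hq : q.Valid (c13OfRecord₁₂ F N θ c₀).δ₀)
    (hcpt : ∀ k (x : Pt 4), ContinuousOn (fun v : Fin (k + 1) → ℝ => limKernel (A1 k v) x) (Box γ₀ k)) :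
    BetaContH γ₀ (betaOfRecord₁₁ F N (θ.toStage11 F N p)) := by
  obtain ⟨R, hA, -⟩ := exists_chainTFac190H_view_of_family F N θ p c₀ lamF hle A1 hm hcF hleafF Ps hn hsp h213 hR hC hs Wn instW
    instWs emb hemb hH D V instV instVs Fw hFd r hfac t hconv ha
  exact betaContH_betaOfRecord₁₁_of_exists_chainTFac190H F N (θ.toStage11 F N p) ⟨R, hA⟩ hC (r22gen_half_c13OfRecord₁₂ F N θ c₀) hq hs hcpt

/-- **N26 AT THE STAGE-12 DATUM FROM THE RECORD's [B13] FAMILY + N10's FAMILY LEAF — `h22`-FREE** (provisos `hP`; p461633's `n26_datumOfRecord₁₂_of_exists_chainTFac190H_view`):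
the family list, the (1.22) identification at the view, N1 ∕ N3 at the letters of record and (C-pt), on a box `0 < γ₀ ≤ θ.γ` ⟹ `∃ γc > 0, BetaContH γc (datumOfRecord₁₂ F N θ hP).βfun`.
Instance 0∕1; N26 NOT discharged. [cite: Balaban1987RG1, (1.7) p.261, (1.20)-(1.22) p.264, (4.4) p.281 and (5.10) p.293; Balaban1988RG2Cluster, p.15, Lemma 3 (2.38) p.20 and p.21; Balaban1985Variational, (190) p.308] -/
theorem n26_datumOfRecord₁₂_of_family (hP : θ.Provisos₁₂ F N) (hq : q.Valid (c13OfRecord₁₂ F N θ c₀).δ₀)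
    (hcpt : ∀ k (x : Pt 4), ContinuousOn (fun v : Fin (k + 1) → ℝ => limKernel (A1 k v) x) (Box γ₀ k)) (hγ₀ : 0 < γ₀) :
    ∃ γc : ℝ, 0 < γc ∧ BetaContH γc (datumOfRecord₁₂ F N θ hP).βfun := by
  obtain ⟨R, hA, -⟩ := exists_chainTFac190H_view_of_family F N θ p c₀ lamF hle A1 hm hcF hleafF Ps hn hsp h213 hR hC hs Wn instW
    instWs emb hemb hH D V instV instVs Fw hFd r hfac t hconv ha
  exact n26_datumOfRecord₁₂_of_exists_chainTFac190H_view F N θ hP p hγ₀ ⟨R, hA⟩ hC (r22gen_half_c13OfRecord₁₂ F N θ c₀) hq hs hcpt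

/-- **N25's END ∧ N26 AT THE STAGE-12 DATUM FROM THE RECORD's [B13] FAMILY + N10's FAMILY LEAF + ROW (D1)'s RESIDUE — `h22`-FREE**: row (D1)'s residue
`Gaps.D1Residue.Residue Lc Js Nc μ' ν'` pinned on the view's one-loop numbers of record (= the one-loop field of EVERY split of the datum's β, p461633 §0), the family list, the
(1.22) identification at the view, N1 ∕ N3 at the letters of record, the one-loop slope `ε₁·K_rem,L ≤ stepBal Nc Lc` and (C-pt), box `0 < γ₀ ≤ θ.γ` ⟹
`EndpointExistence D.C.toB12 ∧ ∃ γc > 0, BetaContH γc D.βfun` at `D := datumOfRecord₁₂ F N θ hP` (p461633's `endpoint_and_n26_datumOfRecord₁₂_of_residue_atSlopeCont`).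
Instance 0∕1 on (D1) and (D4); N25 ∕ N26 NOT discharged. [cite: Balaban1987RG1, Thm 2 p.259 (first sentence), (1.7) p.261, (1.20)-(1.22) p.264 and (2.12)-(2.13) p.268; Balaban1988RG2Cluster, p.15, Lemma 3 (2.38) p.20 and p.21; Balaban1985Variational, (190) p.308] -/
theorem endpoint_and_n26_datumOfRecord₁₂_of_family (hP : θ.Provisos₁₂ F N) {Lc : ℕ} [NeZero Lc] (Js : ℕ → JetData 3 Lc)
    {Nc : ℝ} {μ' ν' : Fin 4} (hβ : ∀ j, beta0OfRecord₁₁ F N (θ.toStage11 F N p) j = B12Beta.secondMoment (TbalOf Lc Js j) μ' ν')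
    (h1 : D1Residue.Residue Lc Js Nc μ' ν') (hγ₀ : 0 < γ₀) (hq : q.Valid (c13OfRecord₁₂ F N θ c₀).δ₀)
    (hsmall : (c13OfRecord₁₂ F N θ c₀).ε₁ * remCoeffL 4 M (c13OfRecord₁₂ F N θ c₀) α₂ q.B₃ ≤ B12Normalization.stepBal Nc Lc)
    (hcpt : ∀ k (x : Pt 4), ContinuousOn (fun v : Fin (k + 1) → ℝ => limKernel (A1 k v) x) (Box γ₀ k)) :
    EndpointExistence (datumOfRecord₁₂ F N θ hP).C.toB12 ∧
      ∃ γc : ℝ, 0 < γc ∧ BetaContH γc (datumOfRecord₁₂ F N θ hP).βfun :=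
  endpoint_and_n26_datumOfRecord₁₂_of_residue_atSlopeCont F N θ hP (oneLoopSplitOfRecord₁₁ F N (θ.toStage11 F N p)) Js hβ h1 hγ₀
    (atSlopeCont_view_of_family F N θ p c₀ lamF hle A1 hm hcF hleafF Ps hn hsp h213 hR hC hs Wn instW instWs emb hemb hH D V instV
      instVs Fw hFd r hfac t hconv ha hq hsmall hcpt)

/-- **CRUX K2′'s REGISTERED STUB `stub_d4AtSlopeCont12 : D4AtSlopeOfD1Record12` AT THE TUPLE θ, IN THE STUB's OWN LETTERS, FROM THE RECORD's [B13] FAMILY — `h22`-FREE**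
(plan g64 `D64-REV15/K2Skeleton12.lean`; the stub's body at `(F, θ)` reads, for every (D1) datum `(Lc, Js, Nc)` pinned on the record's one-loop numbers,
`∃ γ₀, 0 < γ₀ ∧ γ₀ ≤ θ.γ ∧ AtSlopeCont (oneLoopSplit_betaOfMerged (betaMerged F ℰ_θ θ.ρ8 θ.bV) (beta0OfMerged (betaMerged F ℰ_θ θ.ρ8 θ.bV) θ.v₀) θ.γ) γ₀ (stepBal Nc Lc)`
with `ℰ_θ := mergedTermFamilyMatT F N (TcOfRecord F N) (chiFixed7 F N θ.ν) θ.εbg`): THAT conclusion, at the slope `stepBal Nc Lc` of any (D1) datum, ⇐ the family list of this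
section on a box `0 < γ₀ ≤ θ.γ` + the (1.22) identification at the view + N1 ∕ N3 at the letters of record + the one-loop slope + (C-pt) — the stub's DEFINITIONAL split IS
`oneLoopSplitOfRecord₁₁ F N (θ.toStage11 F N p)` (kernel defeq, p470063), so this is `atSlopeCont_view_of_family` re-read.  A REDUCTION of the stub at θ to displayed inputs on
the record's residual FAMILY — NOT a proof of the stub (instance 0∕1). [cite: Balaban1988RG2Cluster, Lemma 3 (2.38) p.20 and p.21; Balaban1987RG1, Thm 3 p.264, (1.20)-(1.22) p.264, (2.12)-(2.13) p.268 and (5.10) p.293; Balaban1985Variational, (190) p.308] -/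
theorem d4AtSlopeOfD1Record12_at_of_family (hγ₀ : 0 < γ₀) (hq : q.Valid (c13OfRecord₁₂ F N θ c₀).δ₀) {Lc : ℕ} {Nc : ℝ}
    (hsmall : (c13OfRecord₁₂ F N θ c₀).ε₁ * remCoeffL 4 M (c13OfRecord₁₂ F N θ c₀) α₂ q.B₃ ≤ B12Normalization.stepBal Nc Lc)
    (hcpt : ∀ k (x : Pt 4), ContinuousOn (fun v : Fin (k + 1) → ℝ => limKernel (A1 k v) x) (Box γ₀ k)) :
    letI := θ.instVβ₁; letI := θ.instVβ₂; letI := θ.instιβ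
    ∃ γ₁ : ℝ, 0 < γ₁ ∧ γ₁ ≤ θ.γ ∧
      AtSlopeCont
        (oneLoopSplit_betaOfMerged (betaMerged F (mergedTermFamilyMatT F N (TcOfRecord F N) (chiFixed7 F N θ.ν) θ.εbg) θ.ρ8 θ.bV)
          (beta0OfMerged (betaMerged F (mergedTermFamilyMatT F N (TcOfRecord F N) (chiFixed7 F N θ.ν) θ.εbg) θ.ρ8 θ.bV) θ.v₀) θ.γ)
        γ₁ (B12Normalization.stepBal Nc Lc) :=
  ⟨γ₀, hγ₀, hle,
    atSlopeCont_view_of_family F N θ p c₀ lamF hle A1 hm hcF hleafF Ps hn hsp h213 hR hC hs Wn instW instWs emb hemb hH D V instV instVs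
      Fw hFd r hfac t hconv ha hq hsmall hcpt⟩

/-- **K2′'s STUB AT θ FROM THE RECORD's [B13] FAMILY, (C-pt) REPLACED BY (C-leaf) IN THE (1.7) LETTERS — `h22`-FREE**: as `d4AtSlopeOfD1Record12_at_of_family` with its last
hypothesis — continuity in the history of the SUMMED site kernel — replaced by continuity in the history of the (1.7) read-outs `v ↦ Re ∂²(Fw k v Y)(t k v Y 0, t k v Y z)` per
scale, domain and site on the box (p472048's `atSlopeCont_of_chainTFac190H_leafwise`, the read-out `ha` on the box: the summation over the domains is paid by the chain's own
history-free majorant).  A REDUCTION of the stub at θ — NOT a proof of it; instance 0∕1. [cite: Balaban1988RG2Cluster, Lemma 3 (2.38) p.20 and p.21; Balaban1987RG1, (1.7) p.261, (1.20)-(1.22) p.264 and (5.1) p.292; Balaban1985Variational, (190) p.308] -/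
theorem d4AtSlopeOfD1Record12_at_of_family_leafwise (hγ₀ : 0 < γ₀) (hq : q.Valid (c13OfRecord₁₂ F N θ c₀).δ₀) {Lc : ℕ} {Nc : ℝ}
    (hsmall : (c13OfRecord₁₂ F N θ c₀).ε₁ * remCoeffL 4 M (c13OfRecord₁₂ F N θ c₀) α₂ q.B₃ ≤ B12Normalization.stepBal Nc Lc)
    (hcont : ∀ k (Y : LDom 4) (z : Pt 4),
      ContinuousOn (fun v : Fin (k + 1) → ℝ => (mixedDeriv (Fw k v Y) (t k v Y 0) (t k v Y z)).re) (Box γ₀ k)) :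
    letI := θ.instVβ₁; letI := θ.instVβ₂; letI := θ.instιβ
    ∃ γ₁ : ℝ, 0 < γ₁ ∧ γ₁ ≤ θ.γ ∧
      AtSlopeCont
        (oneLoopSplit_betaOfMerged (betaMerged F (mergedTermFamilyMatT F N (TcOfRecord F N) (chiFixed7 F N θ.ν) θ.εbg) θ.ρ8 θ.bV)
          (beta0OfMerged (betaMerged F (mergedTermFamilyMatT F N (TcOfRecord F N) (chiFixed7 F N θ.ν) θ.εbg) θ.ρ8 θ.bV) θ.v₀) θ.γ)
        γ₁ (B12Normalization.stepBal Nc Lc) := by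
  obtain ⟨R, hA1, -⟩ := exists_chainTFac190H_view_of_family F N θ p c₀ lamF hle A1 hm hcF hleafF Ps hn hsp h213 hR hC hs Wn instW
    instWs emb hemb hH D V instV instVs Fw hFd r hfac t hconv ha
  subst hA1
  exact ⟨γ₀, hγ₀, hle, atSlopeCont_of_chainTFac190H_leafwise R hC (r22gen_half_c13OfRecord₁₂ F N θ c₀) hq hs hsmall
    fun k Y z => (hcont k Y z).congr fun v hv => ha k v hv Y z⟩

end Family

/-! ## §2 (v1.1) LOCATED — N1 AT THE LETTERS OF RECORD IS A DEMAND ON THE RECORD's (I.1.18) DECAY RATE: `CondsL 4 (c13OfRecord₁₂ θ c₀) ℓ` forces `128·log 162 ≤ θ.s2.lf.κ`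
(and, at ℓ = ½L, the Kotecký–Preiss form `10·(64·log 162 + 1) ≤ (½L − 1)·κ` of [II] p. 21 «κ sufficiently large»); at any Stage-12 tuple with `θ.s2.lf.κ ≤ 128` — in particular at
NODE 00's displayed default term constants (`Node00.Record12Numerics.lfConstsOfRecord₁₂`, `κ := 1`; K0′'s witness of record `theta12OfRecord` has these by `theta12OfRecord_s2`,
`rfl`; by name below: `not_condsL_c13OfRecord₁₂_theta12OfRecord`) — §1's hypothesis `hC` is UNSATISFIABLE for every residual `c₀` and every ℓ, so §1 is VACUOUS there.  This bites ONLY through def-B13's identification `(c13OfRecord₁₂ θ c).κ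
:= θ.s2.lf.κ` ([II] p. 21 ∕ [III] p. 17 (iv): [II]'s κ IS (I.1.18)'s); the free-letter currencies (p470063 §1, an4's p468083, p457986) carry `c.κ` free and are untouched.  What it
asks of NODE 00 (K0′ ∕ def-T ∕ def-B13): a record whose (I.1.18) rate satisfies print's «κ sufficiently large» ([I] p. 257 after (0.25); [II] p. 21) in the numerals the (D4)
wall's concrete carrier produced (`TreeLengthCubeSystem.kappa₀_four`: κ₀ = 64·log 162) — or a revisited identification.  Bookkeeping over tree numerals; nothing of Bałaban's. -/

section Located

open Literature.MathematicalPhysics.QuantumFieldTheory.Balaban1983to89.B12TreeDecay (kappa₀)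
open Literature.MathematicalPhysics.QuantumFieldTheory.Balaban1983to89.TreeLengthCubeSystem (kappa₀_four)

variable (θ : Stage12Params F N) (c₀ : B13.Consts)

/-- N1's `tree` conjunct (the domain sum (0.26)∕(1.26) at half the (I.1.18) rate on the concrete carrier) at ANY letters is the numeral lower bound `128·log 162 ≤ κ`
(`RemainderChainLattice.condsL_four_iff`). [cite: Balaban1987RG1, (0.25)-(0.26) p.257 («with a sufficiently large constant κ»); Balaban1988RG2Cluster, (1.26) p.8] -/
theorem kappa_lower_of_condsL {c : B13.Consts} {ℓ : ℝ} (hC : CondsL 4 c ℓ) : 128 * Real.log 162 ≤ c.κ :=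
  ((condsL_four_iff c ℓ).1 hC).2.2.2

/-- **LOCATED (N26 ∕ (D4) → NODE 00): N1 AT THE LETTERS OF RECORD DEMANDS `128·log 162 ≤ θ.s2.lf.κ`** — the record's (I.1.18) decay rate, through def-B13's
`(c13OfRecord₁₂ θ c).κ = θ.s2.lf.κ`. [cite: Balaban1987RG1, (0.25)-(0.26) p.257 and (1.18) p.263; Balaban1988RG2Cluster, p.21 (after (2.39): «κ sufficiently large»)] -/
theorem kappa_lower_of_condsL_c13OfRecord₁₂ {ℓ : ℝ} (hC : CondsL 4 (c13OfRecord₁₂ F N θ c₀) ℓ) : 128 * Real.log 162 ≤ θ.s2.lf.κ := by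
  have h := kappa_lower_of_condsL hC
  rwa [c13OfRecord₁₂_κ] at h

/-- **… and N1's `large` conjunct at ℓ = ½L, where R22 holds by definition of the letters of record, IS the Kotecký–Preiss lower bound
`10·(64·log 162 + 1) ≤ (½(ℓ₆+1) − 1)·θ.s2.lf.κ`** (`Beta.RemainderChainKP.large_iff_of_R22gen` at `r22gen_half_c13OfRecord₁₂`, κ₀ = 64·log 162 by `TreeLengthCubeSystem.kappa₀_four`).
[cite: Balaban1988RG2Cluster, p.21 (after (2.39) and after (2.41)); Balaban1987RG1, (0.25)-(0.26) p.257] -/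
theorem condsL_large_c13OfRecord₁₂_half_iff :
    (c13OfRecord₁₂ F N θ c₀).κ + 2 * kappa₀ (4 * 2 ^ 4) (2 * 4) + 2 ≤
        (1 - 8 * (c13OfRecord₁₂ F N θ c₀).δ) * ((((c13OfRecord₁₂ F N θ c₀).L : ℝ)) / 2) * (c13OfRecord₁₂ F N θ c₀).κ ↔
      10 * (64 * Real.log 162 + 1) ≤ ((((θ.ℓ₆ + 1 : ℕ) : ℝ)) / 2 - 1) * θ.s2.lf.κ := by
  rw [Beta.RemainderChainKP.large_iff_of_R22gen _ (r22gen_half_c13OfRecord₁₂ F N θ c₀), kappa₀_four, c13OfRecord₁₂_κ, c13OfRecord₁₂_L]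

/-- **AT ANY STAGE-12 TUPLE WITH `θ.s2.lf.κ ≤ 128`, N1 AT THE LETTERS OF RECORD FAILS for every residual `c₀` and every ℓ** (`log 162 > 1` since `e < 3 ≤ 162`) — so §1
(`exists_chainTFac190H_view_of_family` … `d4AtSlopeOfD1Record12_at_of_family_leafwise`) is VACUOUS there.  In particular at NODE 00's displayed default term constants
`Record12Numerics.lfConstsOfRecord₁₂` (`κ := 1`), which K0′'s witness of record carries (`theta12OfRecord_s2`, `rfl`): `not_condsL_c13OfRecord₁₂_of_kappa_eq_one`.
[cite: Balaban1987RG1, (0.25)-(0.26) p.257 («with a sufficiently large constant κ»); Balaban1988RG2Cluster, p.21 (after (2.39))] -/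
theorem not_condsL_c13OfRecord₁₂_of_kappa_le (hκ : θ.s2.lf.κ ≤ 128) (ℓ : ℝ) : ¬ CondsL 4 (c13OfRecord₁₂ F N θ c₀) ℓ := fun hC => by
  have h1 : (1 : ℝ) < Real.log 162 := (Real.lt_log_iff_exp_lt (by norm_num)).2 (Real.exp_one_lt_three.trans (by norm_num))
  have h := kappa_lower_of_condsL_c13OfRecord₁₂ F N θ c₀ hC
  nlinarith

/-- **LOCATED AT THE DISPLAYED DEFAULT `κ = 1`**: if the record's term constants have `κ = 1` (NODE 00's `lfConstsOfRecord₁₂`; K0′'s `theta12OfRecord` by `theta12OfRecord_s2`),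
N1 at the letters of record fails for every `c₀`, ℓ — the (D4) wall's «κ sufficiently large» is a DEMAND on the record's witness, not met by the default.
[cite: Balaban1987RG1, (0.25)-(0.26) p.257; Balaban1988RG2Cluster, p.21 (after (2.39))] -/
theorem not_condsL_c13OfRecord₁₂_of_kappa_eq_one (hκ : θ.s2.lf.κ = 1) (ℓ : ℝ) : ¬ CondsL 4 (c13OfRecord₁₂ F N θ c₀) ℓ :=
  not_condsL_c13OfRecord₁₂_of_kappa_le F N θ c₀ (by rw [hκ]; norm_num) ℓ

/-- **AT K0′'s WITNESS OF RECORD `theta12OfRecord`** (node00-def-K0b's `Node00.Record12Numerics`: `s2 := sect2NumericsOfRecord₁₂`, `lf := lfConstsOfRecord₁₂`, `κ := 1` — all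
`rfl`): N1 at the letters of record FAILS for every residual `c₀` and every ℓ — by name, kernel-checked (`(c13OfRecord₁₂ F N θ₀ c₀).κ = 1` is `rfl`); the live re-pin
`Record12LiveSelector.theta12LiveOfRecord = θ₀.liveRepin` keeps `s2` (`liveRepin_s2`, `rfl`), so the same term closes it there.  So a count THROUGH θ₀ of any `CondsL`-consuming
(D4) ∕ N26 form at the letters of record is vacuous until the witness carries print's «κ sufficiently large».
[cite: Balaban1987RG1, (0.25)-(0.26) p.257 and (1.18) p.263; Balaban1988RG2Cluster, p.21 (after (2.39))] -/
theorem not_condsL_c13OfRecord₁₂_theta12OfRecord (ζ : ZetaOfRecord F N numerics7OfRecord₁₂ 1) (Rz : (K : ℕ) → Sect2.Residual (F.P K) (MatA N))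
    (Zt : (K : ℕ) → TkResidualW F N (FluctV N) K) (ℓ : ℝ) : ¬ CondsL 4 (c13OfRecord₁₂ F N (theta12OfRecord F N ζ Rz Zt) c₀) ℓ :=
  not_condsL_c13OfRecord₁₂_of_kappa_eq_one F N _ c₀ rfl ℓ

end Located

end Summit.QuantumFields.YangMills.Theorems.BalabanUVNodesN26AtRecord12B13Family

end
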